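import Summits.AnomalousDissipation.AnomalousDissipation.Theorems.SawtoothPulseCascadeK1LocalisedCascadeClassStepCT
import Mathlib.Analysis.Complex.ExponentialBounds

/-!
# K1loc, line `Spectral` — helper: THE KERNEL-SIDE CT SCALARS `E` AND `η` (S-D, arbiter A24-2 (2)(b))

Discharges, in the binder shape of `…ClassStepCT.sum_window_iterate_{v,h}step_ct_le`, of two of its scalar hypotheses:
* the tracked energy `E ≤ 1`: `Σ_{n∈F} Σ_{l∈S} |χ_l 𝓕b(l,n)|² ≤ 1` for `|χ| ≤ 1`, `|b| ≤ 1` (Bessel on the torus, a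
  probability space), and its iterate forms for `b_j` (V-step) and `a_j` (H-step);
* the rounding amplitude `η`: `2π(Λ'G)·e^{−M²/2}/(2N) ≤ π(Λ'G)ε/N` whenever `e^{−M²/2} ≤ ε`, with the numeric instances
  `e^{−6²/2} ≤ 2⁻²⁵` and `e^{−10²/2} ≤ 2⁻⁷⁰`.
(The third scalar, the residue count `M_c ≤ 2Q₂/N_j + 1`, is `…CornerTraceCount.card_filter_Icc_dvd_sub_le`.)
-/

-- `Summit.<Summit>.<Problem>`: single-conjunct summit, the duplicate namespace segment is deliberate.
set_option linter.dupNamespace false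

namespace Summit.AnomalousDissipation.AnomalousDissipation.Theorems.SawtoothPulseCascade.K1Window

open MeasureTheory Set Filter Topology UnitAddTorus Function Complex Metric
open scoped Real ENNReal
open Literature.Analysis Literature.Analysis.FunctionSpaces Literature.Analysis.FunctionSpaces.Torus Literature.Analysis.FluidPDE
open Literature.Analysis.FluidPDE.ShearStage
open Literature.Analysis.FluidPDE.SawtoothCascade Literature.Analysis.FluidPDE.SawtoothCascade.CascadeParams
open Summit.AnomalousDissipation.AnomalousDissipation.Theorems.SawtoothPulseCascade.K1Start
open Summit.AnomalousDissipation.AnomalousDissipation.Theorems.SawtoothPulseCascade.K1Flat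
open Summit.AnomalousDissipation.AnomalousDissipation.Theorems.SawtoothPulseCascade.K1Ledger.From

/-! ## §1 The tracked energy `E ≤ 1` -/

/-- The energy of a continuous `b` with `|b| ≤ 1` on the torus (a probability space) is at most `1`. [folklore] -/
theorem integral_norm_sq_le_one_of_norm_le_one {b : UnitAddTorus (Fin 2) → ℂ} (hb1 : ∀ x, ‖b x‖ ≤ 1) :
    ∫ x : UnitAddTorus (Fin 2), ‖b x‖ ^ 2 ≤ 1 := by
  calc ∫ x : UnitAddTorus (Fin 2), ‖b x‖ ^ 2 ≤ ∫ _x : UnitAddTorus (Fin 2), (1 : ℝ) :=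
        integral_mono_of_nonneg (Eventually.of_forall fun x => sq_nonneg _) (integrable_const _)
          (Eventually.of_forall fun x => by
            have h := hb1 x
            have h0 := norm_nonneg (b x)
            nlinarith)
    _ = 1 := by simp

/-- **Tracked energy, V-fibre indexing**: for continuous `b` with `|b| ≤ 1` and a multiplier `|χ| ≤ 1`,
`Σ_{n∈F} Σ_{l∈S} |χ_l 𝓕b(l,n)|² ≤ 1` (distinct coefficients, Bessel). [cite: Grafakos2014, Prop. 3.2.7 (3)] -/
theorem sum_sum_sq_norm_mul_mFourierCoeff_le_one_v {b : UnitAddTorus (Fin 2) → ℂ} (hb : Continuous b)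
    (hb1 : ∀ x, ‖b x‖ ≤ 1) {χ : ℤ → ℂ} (hχ : ∀ l, ‖χ l‖ ≤ 1) (F S : Finset ℤ) :
    ∑ n ∈ F, ∑ l ∈ S, ‖χ l * mFourierCoeff b ![l, n]‖ ^ 2 ≤ 1 := by
  classical
  have h1 : ∑ n ∈ F, ∑ l ∈ S, ‖χ l * mFourierCoeff b ![l, n]‖ ^ 2 ≤ ∑ n ∈ F, ∑ l ∈ S, ‖mFourierCoeff b ![l, n]‖ ^ 2 :=
    Finset.sum_le_sum fun n _ => Finset.sum_le_sum fun l _ => by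
      rw [norm_mul]
      exact pow_le_pow_left₀ (by positivity) (mul_le_of_le_one_left (norm_nonneg _) (hχ l)) 2
  have hinj : Set.InjOn (fun q : ℤ × ℤ => (![q.2, q.1] : Fin 2 → ℤ)) ↑(F ×ˢ S) := by
    rintro ⟨n, l⟩ _ ⟨n', l'⟩ _ h
    have h0 : l = l' := congrFun h 0
    have h1' : n = n' := congrFun h 1
    rw [h0, h1']
  have h2 : ∑ n ∈ F, ∑ l ∈ S, ‖mFourierCoeff b ![l, n]‖ ^ 2 =
      ∑ k ∈ (F ×ˢ S).image (fun q : ℤ × ℤ => (![q.2, q.1] : Fin 2 → ℤ)), ‖mFourierCoeff b k‖ ^ 2 := by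
    rw [Finset.sum_image hinj, Finset.sum_product]
  have h3 := sum_sq_norm_mFourierCoeff_le_integral hb ((F ×ˢ S).image fun q : ℤ × ℤ => (![q.2, q.1] : Fin 2 → ℤ))
  have h4 := integral_norm_sq_le_one_of_norm_le_one hb1
  rw [← h2] at h3
  linarith

/-- **Tracked energy, H-fibre indexing**: `Σ_{n∈F} Σ_{l∈S} |χ_l 𝓕b(n,l)|² ≤ 1` for `|b| ≤ 1`, `|χ| ≤ 1`.
[cite: Grafakos2014, Prop. 3.2.7 (3)] -/
theorem sum_sum_sq_norm_mul_mFourierCoeff_le_one_h {b : UnitAddTorus (Fin 2) → ℂ} (hb : Continuous b)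
    (hb1 : ∀ x, ‖b x‖ ≤ 1) {χ : ℤ → ℂ} (hχ : ∀ l, ‖χ l‖ ≤ 1) (F S : Finset ℤ) :
    ∑ n ∈ F, ∑ l ∈ S, ‖χ l * mFourierCoeff b ![n, l]‖ ^ 2 ≤ 1 := by
  classical
  have h1 : ∑ n ∈ F, ∑ l ∈ S, ‖χ l * mFourierCoeff b ![n, l]‖ ^ 2 ≤ ∑ n ∈ F, ∑ l ∈ S, ‖mFourierCoeff b ![n, l]‖ ^ 2 :=
    Finset.sum_le_sum fun n _ => Finset.sum_le_sum fun l _ => by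
      rw [norm_mul]
      exact pow_le_pow_left₀ (by positivity) (mul_le_of_le_one_left (norm_nonneg _) (hχ l)) 2
  have hinj : Set.InjOn (fun q : ℤ × ℤ => (![q.1, q.2] : Fin 2 → ℤ)) ↑(F ×ˢ S) := by
    rintro ⟨n, l⟩ _ ⟨n', l'⟩ _ h
    have h0 : n = n' := congrFun h 0
    have h1' : l = l' := congrFun h 1
    rw [h0, h1']
  have h2 : ∑ n ∈ F, ∑ l ∈ S, ‖mFourierCoeff b ![n, l]‖ ^ 2 =
      ∑ k ∈ (F ×ˢ S).image (fun q : ℤ × ℤ => (![q.1, q.2] : Fin 2 → ℤ)), ‖mFourierCoeff b k‖ ^ 2 := by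
    rw [Finset.sum_image hinj, Finset.sum_product]
  have h3 := sum_sq_norm_mFourierCoeff_le_integral hb ((F ×ˢ S).image fun q : ℤ × ℤ => (![q.1, q.2] : Fin 2 → ℤ))
  have h4 := integral_norm_sq_le_one_of_norm_le_one hb1
  rw [← h2] at h3
  linarith

/-- A `[0,1]`-valued real multiplier has norm at most `1`. [folklore] -/
theorem norm_le_one_of_unitInterval {χ : ℤ → ℂ} (hχr : ∀ l, ∃ r : ℝ, 0 ≤ r ∧ r ≤ 1 ∧ χ l = (r : ℂ)) (l : ℤ) :
    ‖χ l‖ ≤ 1 := by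
  obtain ⟨r, hr0, hr1, hr⟩ := hχr l
  rw [hr, Complex.norm_real, Real.norm_of_nonneg hr0]; exact hr1

section Cascade

variable (P : CascadeParams)

/-- **`E ≤ 1` for the V-step of the cascade iterates**, in the binder shape of
`…ClassStepCT.sum_window_iterate_vstep_ct_le` (`b = b_j`, `|b_j| ≤ 1`). [cite: Grafakos2014, Prop. 3.2.7 (3)] -/
theorem sum_trackedEnergy_iterate_vstep_le_one (hδ₀ : 0 < P.δ₀) (hd : 0 < P.d)
    (a b : ℕ → UnitAddTorus (Fin 2) → ℝ) (has : ∀ j, IsSmooth (a j)) (h0 : a 0 = datum)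
    (hb : ∀ j, b j = a j ∘ shearMap 0 1 (amp ⟨P.U j, P.U_periodic j, P.contDiff_U (P.δ_pos hδ₀ hd j)⟩ P.γ))
    (hab : ∀ j, a (j + 1) = b j ∘ shearMap 1 0 (amp ⟨P.U j, P.U_periodic j, P.contDiff_U (P.δ_pos hδ₀ hd j)⟩ P.γ))
    (j : ℕ) (χ : ℤ → ℂ) (hχr : ∀ l, ∃ r : ℝ, 0 ≤ r ∧ r ≤ 1 ∧ χ l = (r : ℂ)) (W : Finset (Fin 2 → ℤ)) (Q₂ : ℕ) :
    ∑ n ∈ W.image (fun k => k 1), ∑ l ∈ Finset.Icc (-(Q₂ : ℤ)) Q₂,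
      ‖χ l * mFourierCoeff (fun x => (b j x : ℂ)) ![l, n]‖ ^ 2 ≤ 1 := by
  have hbs : IsSmooth (b j) := isSmooth_b P hδ₀ hd a b has hb j
  have hbc : Continuous fun x => (b j x : ℂ) := Complex.continuous_ofReal.comp hbs.continuous
  have hb1 : ∀ x, ‖(b j x : ℂ)‖ ≤ 1 := fun x => by
    rw [Complex.norm_real, Real.norm_eq_abs]
    exact (abs_iterate_le_one P hδ₀ hd a b h0 hb hab j).2 x
  exact sum_sum_sq_norm_mul_mFourierCoeff_le_one_v hbc hb1 (norm_le_one_of_unitInterval hχr) _ _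

/-- **`E ≤ 1` for the H-step of the cascade iterates**, in the binder shape of
`…ClassStepCT.sum_window_iterate_hstep_ct_le` (`b = a_j`, `|a_j| ≤ 1`). [cite: Grafakos2014, Prop. 3.2.7 (3)] -/
theorem sum_trackedEnergy_iterate_hstep_le_one (hδ₀ : 0 < P.δ₀) (hd : 0 < P.d)
    (a b : ℕ → UnitAddTorus (Fin 2) → ℝ) (has : ∀ j, IsSmooth (a j)) (h0 : a 0 = datum)
    (hb : ∀ j, b j = a j ∘ shearMap 0 1 (amp ⟨P.U j, P.U_periodic j, P.contDiff_U (P.δ_pos hδ₀ hd j)⟩ P.γ))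
    (hab : ∀ j, a (j + 1) = b j ∘ shearMap 1 0 (amp ⟨P.U j, P.U_periodic j, P.contDiff_U (P.δ_pos hδ₀ hd j)⟩ P.γ))
    (j : ℕ) (χ : ℤ → ℂ) (hχr : ∀ l, ∃ r : ℝ, 0 ≤ r ∧ r ≤ 1 ∧ χ l = (r : ℂ)) (W : Finset (Fin 2 → ℤ)) (Q₂ : ℕ) :
    ∑ n ∈ W.image (fun k => k 0), ∑ l ∈ Finset.Icc (-(Q₂ : ℤ)) Q₂,
      ‖χ l * mFourierCoeff (fun x => (a j x : ℂ)) ![n, l]‖ ^ 2 ≤ 1 := by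
  have hac : Continuous fun x => (a j x : ℂ) := Complex.continuous_ofReal.comp (has j).continuous
  have ha1 : ∀ x, ‖(a j x : ℂ)‖ ≤ 1 := fun x => by
    rw [Complex.norm_real, Real.norm_eq_abs]
    exact (abs_iterate_le_one P hδ₀ hd a b h0 hb hab j).1 x
  exact sum_sum_sq_norm_mul_mFourierCoeff_le_one_h hac ha1 (norm_le_one_of_unitInterval hχr) _ _

end Cascade

/-! ## §2 The rounding amplitude `η` -/

/-- **The `η`-hypothesis of the CT blocks from a bound on `e^{−M²/2}`**: `2π(Λ'G)·(e^{−M²/2}/(2N)) ≤ π(Λ'G)ε/N` if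
`e^{−M²/2} ≤ ε`. [folklore] -/
theorem eta_ct_le (Λ' G : ℕ) {N : ℕ} (hN : 0 < N) {M ε : ℝ} (hε : Real.exp (-(M ^ 2 / 2)) ≤ ε) :
    2 * π * ((Λ' * G : ℕ) : ℝ) * (Real.exp (-(M ^ 2 / 2)) / (2 * N)) ≤ π * ((Λ' * G : ℕ) : ℝ) * ε / N := by
  have hNr : (0 : ℝ) < N := by exact_mod_cast hN
  have e : 2 * π * ((Λ' * G : ℕ) : ℝ) * (Real.exp (-(M ^ 2 / 2)) / (2 * N)) =
      π * ((Λ' * G : ℕ) : ℝ) * Real.exp (-(M ^ 2 / 2)) / N := by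
    field_simp
  rw [e]
  exact div_le_div_of_nonneg_right (mul_le_mul_of_nonneg_left hε (by positivity)) hNr.le

/-- Numeric instance `M = 6`: `e^{−6²/2} = e^{−18} ≤ 2⁻²⁵`. [folklore] -/
theorem exp_neg_sq_half_six_le : Real.exp (-((6 : ℝ) ^ 2 / 2)) ≤ (2 : ℝ)⁻¹ ^ 25 := by
  have h1 : (2.7182818283 : ℝ) < Real.exp 1 := Real.exp_one_gt_d9
  have h18 : Real.exp (-((6 : ℝ) ^ 2 / 2)) = (Real.exp 1 ^ 18)⁻¹ := by
    rw [← Real.exp_nat_mul, ← Real.exp_neg]; norm_num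
  rw [h18, inv_pow]
  have h2 : (2 : ℝ) ^ 25 ≤ (2.7182818283 : ℝ) ^ 18 := by norm_num
  have h3 : (2.7182818283 : ℝ) ^ 18 ≤ Real.exp 1 ^ 18 := pow_le_pow_left₀ (by norm_num) h1.le 18
  exact inv_anti₀ (by positivity) (h2.trans h3)

/-- Numeric instance `M = 10`: `e^{−10²/2} = e^{−50} ≤ 2⁻⁷⁰`. [folklore] -/
theorem exp_neg_sq_half_ten_le : Real.exp (-((10 : ℝ) ^ 2 / 2)) ≤ (2 : ℝ)⁻¹ ^ 70 := by
  have h1 : (2.7182818283 : ℝ) < Real.exp 1 := Real.exp_one_gt_d9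
  have h50 : Real.exp (-((10 : ℝ) ^ 2 / 2)) = (Real.exp 1 ^ 50)⁻¹ := by
    rw [← Real.exp_nat_mul, ← Real.exp_neg]; norm_num
  rw [h50, inv_pow]
  have h2 : (2 : ℝ) ^ 70 ≤ (2.7182818283 : ℝ) ^ 50 := by norm_num
  have h3 : (2.7182818283 : ℝ) ^ 50 ≤ Real.exp 1 ^ 50 := pow_le_pow_left₀ (by norm_num) h1.le 50
  exact inv_anti₀ (by positivity) (h2.trans h3)

/-- **The `η`-hypothesis at `M = 10`**: `2π(Λ'G)e^{−50}/(2N) ≤ π(Λ'G)2⁻⁷⁰/N`. [folklore] -/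
theorem eta_ct_ten_le (Λ' G : ℕ) {N : ℕ} (hN : 0 < N) :
    2 * π * ((Λ' * G : ℕ) : ℝ) * (Real.exp (-((10 : ℝ) ^ 2 / 2)) / (2 * N)) ≤
      π * ((Λ' * G : ℕ) : ℝ) * (2 : ℝ)⁻¹ ^ 70 / N :=
  eta_ct_le Λ' G hN exp_neg_sq_half_ten_le

end Summit.AnomalousDissipation.AnomalousDissipation.Theorems.SawtoothPulseCascade.K1Window
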